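import Literature.Topology.FourManifolds.CappellShanesonGompfReduction
import Literature.Topology.FourManifolds.SurgeredMappingTorus
import HarnessLib

/-!
# Gompf's Theorem 2.1 on the 3-torus in Dehn-twist form, and the Δ-move leaf `gompf2010_deltaMove`

Third file of the decomposition of the named fact
`Literature.Topology.FourManifolds.nonempty_diffeomorph_sphere_four_of_isCappellShanesonSphereOf` (R. Gompf, *More
Cappell–Shaneson spheres are standard*, Algebr. Geom. Topol. 10 (2010), Examples 3.1(a)).
`CappellShanesonGompfReduction.lean` reduced it to three leaves, the first being the Δ-move
`Literature.Topology.FourManifolds.gompf2010_deltaMove` (Gompf's Theorem 2.1 *and* the isotopy "`δ` is isotopic to `Δ`" of §3: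
for `A` in standard form the row move `A ↦ Δᵏ A` does not change the Cappell–Shaneson spheres);
`SurgeredMappingTorus.lean` proved the isotopy part (Dehn twists `δ_f` of `T³` along the torus
spanned by the first and third coordinate circles may be replaced by the linear map `Δᵏ` in
surgered mapping tori). This file supplies the Dehn-twist side of the dictionary between the
printed Theorem 2.1 — "`X^ε_{φ∘δᵏ} = X^ε_φ = X^ε_{δᵏ∘φ}` for all `k ∈ ℤ` and `ε = 0, 1`", with `δ`
a genuine Dehn twist of `M = T³` supported off the base point — and the matrix-level leaf:

* genuine Dehn twists (`Literature.Topology.FourManifolds.IsDehnTwistLift`: smooth lifts making one full turn across a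
  collar arc `[a, b] ⊂ (0, 2π)` of the second coordinate circle and constant outside it, so that
  the base point `1` is outside the support; their powers `δ_fᵏ`,
  `Literature.Topology.FourManifolds.IsDehnTwistLift.twistPow`) and their **existence** (`Literature.Topology.FourManifolds.gompfLift a b`, the
  smooth staircase `θ ↦ 2π S((θ - a)/(b - a))` on `(-π, π]` continued quasi-periodically, built
  from a smooth function on the circle so that smoothness is automatic);
* the bookkeeping of "same surgered mapping tori up to diffeomorphism"
  (`Literature.Topology.FourManifolds.SurgeredMappingToriLE`);
* **the column move is the conjugate of the row move**
  (`Literature.Topology.FourManifolds.IsSurgeredMappingTorusOf.torusDiffeomorph_mul_comm`: `P A = A⁻¹ (A P) A`, and surgered mapping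
  tori of linear monodromies are invariant under based conjugation — Gompf §3 ¶1, ¶3);
* **Theorem 2.1 on `T³` in Dehn-twist form follows from the row move**
  (`Literature.Topology.FourManifolds.gompf2010_deltaMove.surgeredMappingToriLE_twistPow`: under `gompf2010_deltaMove`, for every `A`
  in standard form with `det (A - 1) = 1`, every Dehn-twist lift `f` and every `k ∈ ℤ`, the closed
  smooth 4-manifolds that are surgered mapping tori of `A ∘ δ_fᵏ`, of `A` and of `δ_fᵏ ∘ A` are the
  same up to diffeomorphism, all four inclusions), and **conversely the row move follows from one
  clause of it for any one Dehn-twist lift**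
  (`Literature.Topology.FourManifolds.gompf2010_deltaMove_of_surgeredMappingToriLE`).

D-0026 record (bad-split review, 2026-08-15). The Dehn-twist form used to be isolated here as a
second named fact ("Theorem 2.1 of loc. cit. for `M = T³` and a linear monodromy in standard
form"), with the same citation as `gompf2010_deltaMove` (Thm 2.1 and §3 ¶3); once the two were
proved equivalent in this file it was one proof obligation counted twice, and it has been **merged
back into the parent leaf**: the equivalence survives as the two theorems of the last bullet, the
former consumers (`CappellShanesonDeltaMoveProofs.lean`, `CappellShanesonDeltaMoveOne.lean`,
`Barriers/SmoothPoincare4/CappellShanesonFamilyStandardProofs.lean`) take `gompf2010_deltaMove`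
instead, and no named fact is declared in this file. The remaining obligation is unchanged and
single: Theorem 2.1 proper (the fishtail neighbourhood and Lemma 2.2) in its framed form **F** =
`gompf2010_framedTwist` (`GompfTheorem43.lean`; glue `gompf2010_deltaMove_of_framedTwist'`).

## References

* R. E. Gompf, *More Cappell–Shaneson spheres are standard*, Algebr. Geom. Topol. 10 (2010)
  1665–1681, doi:10.2140/agt.2010.10.1665 (arXiv:0908.1914): Thm 2.1 and the definition of `δ`
  following it; §3 ¶1 (conjugacy invariance), §3 ¶3 (application to `T³`, standard form, the
  matrix `Δ`, row and column moves). [GompfAGT2010]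
-/

open scoped Manifold ContDiff Topology Real
open Set Function

noncomputable section

namespace Literature.Topology.FourManifolds

universe u

/-- Local notation: `𝔼 n` is the model Euclidean space `EuclideanSpace ℝ (Fin n)`. -/
local notation "𝔼 " n:arg => EuclideanSpace ℝ (Fin n)

/-- Local notation: `𝕊 n` is the unit sphere in `EuclideanSpace ℝ (Fin (n + 1))`. -/
local notation "𝕊 " n:arg => (Metric.sphere (0 : EuclideanSpace ℝ (Fin (n + 1))) 1)

/-- Local notation: the model with corners `𝓣 = (𝓡 1).prod ((𝓡 1).prod (𝓡 1))` of `ThreeTorus`. -/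
local notation "𝓣" =>
  (ModelWithCorners.prod (𝓡 1) (ModelWithCorners.prod (𝓡 1) (𝓡 1)))

attribute [local instance] finrank_real_complex_fact'

/-! ### Lifts of Dehn twists -/

section Lifts

/-- **Lifts of Dehn twists of an annulus / of Gompf's `δ`.** `IsDehnTwistLift f` says that
`f : ℝ → ℝ` is smooth, makes one full turn per period (`f (θ + 2π) = f θ + 2π`), and is a smooth
monotone step across a collar arc: for some `0 < a < b < 2π`, `f = 0` on `[0, a]`, `f = 2π` on
`[b, 2π]` and `f` is monotone on `[a, b]`. The circle map `e^{iθ} ↦ e^{i f θ}` is then the identity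
outside the arc `{arg ∈ (a, b)}` and turns once across it, so `torusDehnTwist f 1` is
`(Dehn twist of the annulus {arg z₂ ∈ [a, b]} × S¹) × id_{S¹}` on the collar
`{arg z₂ ∈ [a, b]} ≅ I × S¹ × S¹` of the torus `{z₂ = 1} ⊂ T³` spanned by the first and third
coordinate circles, twisting in the direction `e₃ - e₁`, and the identity near the base point `1`
— Gompf's "more careful definition of `δ`": "identify a collar of `T` in `M` with `I × S¹ × S¹` so
that the first `S¹`-factor is homologous to `φ_*[α] - [α]`, then take `δ = (Dehn twist) × id_{S¹}`
… we can assume [`p`] is outside the support of `δ`" (Gompf 2010, after Thm 2.1; §3: along the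
torus spanned by the first and third coordinate axes, in the direction `A v - v = [-1 0 1]ᵀ`). [cite: GompfAGT2010, §2 (definition of δ after Thm 2.1) and §3] -/
def IsDehnTwistLift (f : ℝ → ℝ) : Prop :=
  ContDiff ℝ ∞ f ∧ (∀ θ, f (θ + 2 * π) = f θ + 2 * π) ∧
    ∃ a b : ℝ, 0 < a ∧ a < b ∧ b < 2 * π ∧ (∀ θ ∈ Icc 0 a, f θ = 0) ∧
      (∀ θ ∈ Icc b (2 * π), f θ = 2 * π) ∧ MonotoneOn f (Icc a b)

namespace IsDehnTwistLift

variable {f : ℝ → ℝ} (hf : IsDehnTwistLift f)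
include hf

/-- A Dehn-twist lift is smooth. [folklore] -/
theorem contDiff : ContDiff ℝ ∞ f := hf.1

/-- A Dehn-twist lift has degree one: `f (θ + 2π) = f θ + 2π · 1`. [folklore] -/
theorem periodic (θ : ℝ) : f (θ + 2 * π) = f θ + 2 * π * ((1 : ℤ) : ℝ) := by
  rw [hf.2.1]; push_cast; ring

/-- A Dehn-twist lift vanishes at `0` (the base point is outside the support). [folklore] -/
theorem apply_zero : f 0 = 0 := by
  obtain ⟨a, b, ha, -, -, h0, -⟩ := hf.2.2
  exact h0 0 ⟨le_rfl, ha.le⟩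

/-- The `k`-fold lift `k f` is smooth. [folklore] -/
theorem contDiff_int_mul (k : ℤ) : ContDiff ℝ ∞ fun θ ↦ (k : ℝ) * f θ :=
  contDiff_const.mul hf.1

/-- The `k`-fold lift `k f` has degree `k`. [folklore] -/
theorem periodic_int_mul (k : ℤ) (θ : ℝ) : (k : ℝ) * f (θ + 2 * π) = k * f θ + 2 * π * k := by
  rw [hf.2.1]; ring

/-- **The `k`-th power `δ_fᵏ` of the Dehn twist with lift `f`**, realised as the twist with the
degree-`k` lift `k f` (`twistPow_zero`, `twistPow_add_one`, `twistPow_one` identify it with the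
`k`-fold iterate of `δ_f = torusDehnTwist f 1`). [cite: GompfAGT2010, Thm 2.1 (δ^k)] -/
def twistPow (k : ℤ) : ThreeTorus ≃ₘ⟮𝓣, 𝓣⟯ ThreeTorus :=
  torusDehnTwist (fun θ ↦ (k : ℝ) * f θ) k (hf.contDiff_int_mul k) (hf.periodic_int_mul k)

/-- The underlying map of `δ_fᵏ`. [folklore] -/
@[simp] theorem coe_twistPow (k : ℤ) :
    ⇑(hf.twistPow k) = torusTwist (circleMapOfLift fun θ ↦ (k : ℝ) * f θ) := rfl

/-- `δ_fᵏ` fixes the base point. [folklore] -/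
theorem twistPow_apply_one (k : ℤ) : hf.twistPow k 1 = 1 :=
  torusTwist_apply_one (circleMapOfLift_one (by simp [hf.apply_zero]))

/-- `δ_f⁰ = id`. [folklore] -/
theorem twistPow_zero : hf.twistPow 0 = Diffeomorph.refl 𝓣 ThreeTorus ∞ := by
  refine Diffeomorph.ext fun z ↦ ?_
  rw [coe_twistPow, Diffeomorph.coe_refl, id]
  have h1 : (circleMapOfLift fun θ ↦ ((0 : ℤ) : ℝ) * f θ) = fun _ ↦ 1 :=
    funext fun w ↦ by simp only [Int.cast_zero, zero_mul]; exact circleMapOfLift_zero w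
  rw [h1, torusTwist_one, id]

/-- `δ_f¹ = δ_f`. [folklore] -/
theorem twistPow_one : hf.twistPow 1 = torusDehnTwist f 1 hf.contDiff hf.periodic := by
  refine Diffeomorph.ext fun z ↦ ?_
  simp only [coe_twistPow, coe_torusDehnTwist, Int.cast_one, one_mul]

/-- `δ_f^{j + k} = δ_fᵏ ∘ δ_fʲ` (lifts add). [folklore] -/
theorem twistPow_add (j k : ℤ) : hf.twistPow (j + k) = (hf.twistPow j).trans (hf.twistPow k) := by
  refine Diffeomorph.ext fun z ↦ ?_
  rw [Diffeomorph.coe_trans, Function.comp_apply, coe_twistPow, coe_twistPow, coe_twistPow,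
    torusTwist_torusTwist]
  congr 1
  funext w
  rw [← circleMapOfLift_add]
  congr 1
  funext θ
  push_cast
  ring

/-- `δ_f^{k + 1} = δ_f ∘ δ_fᵏ`: `twistPow` is the iterate of the Dehn twist. [folklore] -/
theorem twistPow_add_one (k : ℤ) :
    hf.twistPow (k + 1) = (hf.twistPow k).trans (torusDehnTwist f 1 hf.contDiff hf.periodic) := by
  rw [twistPow_add, twistPow_one]

end IsDehnTwistLift

/-! ### Existence of Dehn-twist lifts: the smooth staircase -/

/-- The angular part of the staircase, as a function on the circle:
`dehnProfileCircle a b z = 2π S((arg z - a)/(b - a)) - arg z` with `S = Real.smoothTransition`;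
near `z = -1` (where `arg` jumps) it equals `π - arg (-z)`, so it is smooth. [folklore] -/
def dehnProfileCircle (a b : ℝ) (z : Circle) : ℝ :=
  2 * π * Real.smoothTransition ((Complex.arg (z : ℂ) - a) / (b - a)) - Complex.arg (z : ℂ)

/-- `cos b < 1` and `-1 < cos b` for `0 < b < π`. [folklore] -/
theorem cos_lt_one_of_mem_Ioo {b : ℝ} (hb0 : 0 < b) (hb : b < π) :
    Real.cos b < 1 ∧ -1 < Real.cos b := by
  constructor
  · have := Real.cos_lt_cos_of_nonneg_of_le_pi le_rfl hb.le hb0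
    rwa [Real.cos_zero] at this
  · have := Real.cos_lt_cos_of_nonneg_of_le_pi hb0.le le_rfl hb
    rwa [Real.cos_pi] at this

/-- Off the arc `{|arg| ≤ b}`, i.e. for `re z < cos b`, the profile is `π - arg (-z)`. [folklore] -/
theorem dehnProfileCircle_eq_of_re_lt {a b : ℝ} (ha : 0 < a) (hab : a < b) (hb : b < π) {z : Circle}
    (hz : (z : ℂ).re < Real.cos b) :
    dehnProfileCircle a b z = 2 * π - (Complex.arg (-(z : ℂ)) + π) := by
  have hz0 : (z : ℂ) ≠ 0 := Circle.coe_ne_zero z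
  have hcos : Real.cos (Complex.arg (z : ℂ)) = (z : ℂ).re := by
    rw [Complex.cos_arg hz0, Circle.norm_coe, div_one]
  have habs : b < |Complex.arg (z : ℂ)| := by
    by_contra h
    push Not at h
    have : Real.cos b ≤ Real.cos |Complex.arg (z : ℂ)| :=
      Real.cos_le_cos_of_nonneg_of_le_pi (abs_nonneg _) hb.le h
    rw [Real.cos_abs, hcos] at this
    linarith
  unfold dehnProfileCircle
  rcases lt_or_ge 0 (Complex.arg (z : ℂ)) with hpos | hnonpos
  · rw [abs_of_pos hpos] at habs
    have hS : Real.smoothTransition ((Complex.arg (z : ℂ) - a) / (b - a)) = 1 :=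
      Real.smoothTransition.one_of_one_le (by rw [le_div_iff₀ (sub_pos.2 hab)]; linarith)
    have hneg : Complex.arg (-(z : ℂ)) = Complex.arg (z : ℂ) - π := by
      rw [Complex.arg_neg_eq_arg_sub_pi_iff]
      rcases (Complex.arg_nonneg_iff.1 hpos.le).lt_or_eq with him | him
      · exact Or.inl him
      · refine Or.inr ⟨him.symm, ?_⟩
        by_contra hre
        push Not at hre
        have : Complex.arg (z : ℂ) = 0 := Complex.arg_eq_zero_iff.2 ⟨hre, him.symm⟩
        linarith
    rw [hS, hneg]
    ring
  · rw [abs_of_nonpos hnonpos] at habs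
    have hlt : Complex.arg (z : ℂ) < 0 := by linarith [hab.trans hb, ha]
    have hS : Real.smoothTransition ((Complex.arg (z : ℂ) - a) / (b - a)) = 0 :=
      Real.smoothTransition.zero_of_nonpos
        (div_nonpos_of_nonpos_of_nonneg (by linarith) (sub_pos.2 hab).le)
    have hneg : Complex.arg (-(z : ℂ)) = Complex.arg (z : ℂ) + π :=
      Complex.arg_neg_eq_arg_add_pi_of_im_neg (Complex.arg_neg_iff.1 hlt)
    rw [hS, hneg]
    ring

/-- **The profile is smooth on the circle** (two charts: `arg` away from `-1`, `arg (-·)` near `-1`). [folklore] -/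
theorem contMDiff_dehnProfileCircle {a b : ℝ} (ha : 0 < a) (hab : a < b) (hb : b < π) :
    ContMDiff (𝓡 1) 𝓘(ℝ, ℝ) ∞ (dehnProfileCircle a b) := by
  have hb0 : 0 < b := ha.trans hab
  obtain ⟨hcos1, hcosm1⟩ := cos_lt_one_of_mem_Ioo hb0 hb
  intro z
  by_cases hz : (z : ℂ).re < Real.cos b
  · -- near `z`, the profile is `2π - (arg (-w) + π)`
    have hU : IsOpen {w : Circle | (w : ℂ).re < Real.cos b} :=
      isOpen_lt (Complex.continuous_re.comp continuous_subtype_val) continuous_const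
    have hev : dehnProfileCircle a b =ᶠ[𝓝 z] fun w ↦ 2 * π - (Complex.arg (-(w : ℂ)) + π) :=
      Filter.eventuallyEq_of_mem (hU.mem_nhds hz) fun w hw ↦
        dehnProfileCircle_eq_of_re_lt ha hab hb hw
    have h1 : (z : ℂ) ≠ 1 := fun h ↦ by
      rw [h, Complex.one_re] at hz
      linarith
    have hslit : -(z : ℂ) ∈ Complex.slitPlane :=
      mem_slitPlane_of_norm_eq_one (by rw [norm_neg, Circle.norm_coe]) (by rwa [Ne, neg_inj])
    exact (contMDiffAt_const.sub (contMDiffAt_arg_neg_circle hslit)).congr_of_eventuallyEq hev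
  · push Not at hz
    have h1 : (z : ℂ) ≠ -1 := fun h ↦ by
      rw [h, Complex.neg_re, Complex.one_re] at hz
      linarith
    have harg : ContMDiffAt (𝓡 1) 𝓘(ℝ, ℝ) ∞ (fun w : Circle ↦ Complex.arg (w : ℂ)) z :=
      contMDiffAt_arg_circle (mem_slitPlane_of_norm_eq_one (Circle.norm_coe z) h1)
    have hg : ContDiff ℝ ∞ fun x : ℝ ↦ 2 * π * Real.smoothTransition ((x - a) / (b - a)) - x :=
      (contDiff_const.mul (Real.smoothTransition.contDiff.comp
        ((contDiff_id.sub contDiff_const).div_const _))).sub contDiff_id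
    exact hg.contDiffAt.comp_contMDiffAt harg

/-- **Gompf's Dehn-twist lift with collar `[a, b]`: the smooth staircase.**
`gompfLift a b θ = θ + dehnProfileCircle a b (e^{iθ})`; for `θ ∈ (-π, π]` this is
`2π S((θ - a)/(b - a))` (`gompfLift_eq_of_mem_Ioc`), and `gompfLift a b (θ + 2π) = gompfLift a b θ + 2π`.
It is smooth because it is `id` plus a smooth function on the circle composed with `Circle.exp`. [folklore] -/
def gompfLift (a b θ : ℝ) : ℝ := θ + dehnProfileCircle a b (Circle.exp θ)

/-- Quasi-periodicity of the staircase. [folklore] -/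
theorem gompfLift_add_two_pi (a b θ : ℝ) : gompfLift a b (θ + 2 * π) = gompfLift a b θ + 2 * π := by
  simp only [gompfLift, Circle.exp_add_two_pi]
  ring

/-- On the fundamental domain `(-π, π]` the staircase is the smooth step `2π S((θ - a)/(b - a))`. [folklore] -/
theorem gompfLift_eq_of_mem_Ioc (a b : ℝ) {θ : ℝ} (hθ : θ ∈ Ioc (-π) π) :
    gompfLift a b θ = 2 * π * Real.smoothTransition ((θ - a) / (b - a)) := by
  rw [gompfLift, dehnProfileCircle, Circle.arg_exp hθ.1 hθ.2]
  ring

/-- The staircase is smooth. [folklore] -/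
theorem contDiff_gompfLift {a b : ℝ} (ha : 0 < a) (hab : a < b) (hb : b < π) :
    ContDiff ℝ ∞ (gompfLift a b) :=
  contDiff_id.add ((contMDiff_dehnProfileCircle ha hab hb).comp contMDiff_circleExp).contDiff

/-- The staircase vanishes on `[0, a]` (indeed on `(-π, a]`). [folklore] -/
theorem gompfLift_eq_zero {a b : ℝ} (hab : a < b) (hb : b < π) {θ : ℝ} (h1 : -π < θ)
    (h2 : θ ≤ a) : gompfLift a b θ = 0 := by
  rw [gompfLift_eq_of_mem_Ioc a b ⟨h1, by linarith⟩,
    Real.smoothTransition.zero_of_nonpos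
      (div_nonpos_of_nonpos_of_nonneg (by linarith) (sub_pos.2 hab).le), mul_zero]

/-- The staircase equals `2π` on `[b, 2π]`. [folklore] -/
theorem gompfLift_eq_two_pi {a b : ℝ} (ha : 0 < a) (hab : a < b) (hb : b < π) {θ : ℝ} (h1 : b ≤ θ)
    (h2 : θ ≤ 2 * π) : gompfLift a b θ = 2 * π := by
  rcases le_or_gt θ π with hθ | hθ
  · rw [gompfLift_eq_of_mem_Ioc a b ⟨by linarith [ha.trans hab], hθ⟩,
      Real.smoothTransition.one_of_one_le (by rw [le_div_iff₀ (sub_pos.2 hab)]; linarith),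
      mul_one]
  · have h := gompfLift_add_two_pi a b (θ - 2 * π)
    rw [sub_add_cancel] at h
    rw [h, gompfLift_eq_zero hab hb (by linarith) (by linarith [ha]), zero_add]

/-- The staircase is monotone on the collar `[a, b]`. [folklore] -/
theorem monotoneOn_gompfLift {a b : ℝ} (ha : 0 < a) (hab : a < b) (hb : b < π) :
    MonotoneOn (gompfLift a b) (Icc a b) := by
  intro x hx y hy hxy
  rw [gompfLift_eq_of_mem_Ioc a b ⟨by linarith [hx.1], by linarith [hx.2]⟩,
    gompfLift_eq_of_mem_Ioc a b ⟨by linarith [hy.1], by linarith [hy.2]⟩]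
  refine mul_le_mul_of_nonneg_left (Real.smoothTransition.monotone ?_) (by positivity)
  exact div_le_div_of_nonneg_right (by linarith) (sub_pos.2 hab).le

/-- **Dehn-twist lifts exist**: the staircase with collar `[a, b] ⊂ (0, π)` is one. [folklore] -/
theorem isDehnTwistLift_gompfLift {a b : ℝ} (ha : 0 < a) (hab : a < b) (hb : b < π) :
    IsDehnTwistLift (gompfLift a b) :=
  ⟨contDiff_gompfLift ha hab hb, gompfLift_add_two_pi a b, a, b, ha, hab,
    by linarith [Real.pi_pos], fun θ hθ ↦ gompfLift_eq_zero hab hb (by linarith [hθ.1, Real.pi_pos]) hθ.2,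
    fun θ hθ ↦ gompfLift_eq_two_pi ha hab hb hθ.1 hθ.2, monotoneOn_gompfLift ha hab hb⟩

/-- A fixed Dehn-twist lift (collar `[1, 2] ⊂ (0, π)`), for instantiating universally quantified
statements about Dehn twists. [folklore] -/
theorem isDehnTwistLift_gompfLift_one_two : IsDehnTwistLift (gompfLift 1 2) :=
  isDehnTwistLift_gompfLift one_pos one_lt_two (by linarith [Real.pi_gt_three])

end Lifts

/-! ### Surgered mapping tori up to diffeomorphism -/

section LE

/-- **Inclusion of diffeomorphism types of surgered mapping tori.** `SurgeredMappingToriLE φ ψ`: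
every closed smooth 4-manifold `X : Type u` that is a surgered mapping torus of `φ` is
diffeomorphic to a closed smooth 4-manifold `X' : Type` that is one of `ψ`. Gompf's
"`X_φ^ε = X_ψ^ε` for `ε = 0, 1`" (the two framings give the same diffeomorphism types, framing by
framing) is rendered framing-free as the conjunction of the two inclusions. [cite: GompfAGT2010, §2 (X_φ^ε)] -/
def SurgeredMappingToriLE (φ ψ : ThreeTorus ≃ₘ⟮𝓣, 𝓣⟯ ThreeTorus) : Prop :=
  ∀ (X : Type u) [TopologicalSpace X] [T2Space X] [SecondCountableTopology X]
    [ChartedSpace (𝔼 4) X] [IsManifold (𝓡 4) ∞ X] [CompactSpace X],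
    IsSurgeredMappingTorusOf φ X →
      ∃ (X' : Type) (_ : TopologicalSpace X') (_ : T2Space X') (_ : SecondCountableTopology X')
        (_ : ChartedSpace (𝔼 4) X') (_ : IsManifold (𝓡 4) ∞ X') (_ : CompactSpace X'),
        IsSurgeredMappingTorusOf ψ X' ∧ Nonempty (X ≃ₘ⟮𝓡 4, 𝓡 4⟯ X')

/-- Reflexivity needs a copy of `X : Type u` in `Type`; instead we record the useful monotonicity:
if the predicates for `ψ` and `ψ'` agree on all 4-manifolds in `Type`, the targets may be
exchanged. [folklore] -/
theorem SurgeredMappingToriLE.of_iff_right {φ ψ ψ' : ThreeTorus ≃ₘ⟮𝓣, 𝓣⟯ ThreeTorus}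
    (h : SurgeredMappingToriLE.{u} φ ψ)
    (hiff : ∀ (Y : Type) [TopologicalSpace Y] [ChartedSpace (𝔼 4) Y],
      IsSurgeredMappingTorusOf ψ Y → IsSurgeredMappingTorusOf ψ' Y) :
    SurgeredMappingToriLE.{u} φ ψ' := by
  intro X _ _ _ _ _ _ hX
  obtain ⟨X', _, _, _, _, _, _, h', e⟩ := h X hX
  exact ⟨X', ‹_›, ‹_›, ‹_›, ‹_›, ‹_›, ‹_›, hiff X' h', e⟩

/-- Monotonicity in the source. [folklore] -/
theorem SurgeredMappingToriLE.of_imp_left {φ φ' ψ : ThreeTorus ≃ₘ⟮𝓣, 𝓣⟯ ThreeTorus}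
    (h : SurgeredMappingToriLE.{u} φ ψ)
    (himp : ∀ (Y : Type u) [TopologicalSpace Y] [ChartedSpace (𝔼 4) Y],
      IsSurgeredMappingTorusOf φ' Y → IsSurgeredMappingTorusOf φ Y) :
    SurgeredMappingToriLE.{u} φ' ψ :=
  fun X _ _ _ _ _ _ hX ↦ h X (himp X hX)

end LE

/-! ### The row Δ-move from Theorem 2.1 in Dehn-twist form -/

section DeltaMove

/-- `Δᵏ` acts on `T³` as the linear twist `z ↦ z ^ k` of the second coordinate
(`coe_gompfDelta_zpow`, `torusTwist_zpow`). [cite: GompfAGT2010, §3 (the matrix Δ)] -/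
theorem coe_torusDiffeomorph_gompfDelta_zpow (k : ℤ) :
    ⇑(torusDiffeomorph (gompfDelta ^ k)) = torusTwist fun w ↦ w ^ k := by
  rw [coe_torusDiffeomorph, coe_gompfDelta_zpow, torusTwist_zpow]

/-- **Left Δ-moves from Dehn twists**: a surgered mapping torus of `δ_fᵏ ∘ A` is a
Cappell–Shaneson sphere of `Δᵏ A` (same `X`), for `A` a Cappell–Shaneson matrix in standard form —
`isSurgeredMappingTorusOf_torusDiffeomorph_trans_dehnTwist_iff` with `P = Δᵏ`, and
`det (Δᵏ A - 1) = det (A - 1)`. [cite: GompfAGT2010, §3 (δ is isotopic to Δ)] -/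
theorem IsSurgeredMappingTorusOf.isCappellShanesonSphereOf_gompfDelta_zpow_mul
    {A : Matrix.SpecialLinearGroup (Fin 3) ℤ} (hA : IsGompfStandardForm A)
    (hdet : ((A : Matrix (Fin 3) (Fin 3) ℤ) - 1).det = 1) {f : ℝ → ℝ} (hf : IsDehnTwistLift f)
    (k : ℤ) {X : Type*} [TopologicalSpace X] [ChartedSpace (𝔼 4) X]
    (h : IsSurgeredMappingTorusOf ((torusDiffeomorph A).trans (hf.twistPow k)) X) :
    IsCappellShanesonSphereOf (gompfDelta ^ k * A) X := by
  have h' := (isSurgeredMappingTorusOf_torusDiffeomorph_trans_dehnTwist_iff A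
    (hf.contDiff_int_mul k) (hf.periodic_int_mul k) (by simp [hf.apply_zero])
    (coe_torusDiffeomorph_gompfDelta_zpow k)).1 h
  exact h'.isCappellShanesonSphereOf (Or.inl (by rw [hA.det_gompfDelta_zpow_mul_sub_one]; exact hdet))

/-- **The row Δ-move follows from Theorem 2.1 on the torus — indeed from its clause
"`X_A ≅ X_{δᵏ∘A}`" for any one Dehn twist `δ = δ_{f₀}`** (e.g. the staircase `gompfLift 1 2`).
Given a Cappell–Shaneson sphere `X` of `A` (standard form, `det (A - 1) = 1`) and `k ∈ ℤ`: `X` is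
a surgered mapping torus of `torusDiffeomorph A`; by hypothesis it is diffeomorphic to a surgered
mapping torus `X'` of `δᵏ ∘ A`, which is a Cappell–Shaneson sphere of `Δᵏ A` by the isotopy
`δ ≃ Δ` (`IsSurgeredMappingTorusOf.isCappellShanesonSphereOf_gompfDelta_zpow_mul`) — exactly
Gompf's §3: "`δ` is isotopic to the linear diffeomorphism `Δ`. This allows us to change `A` (in
standard form) by adding any multiple of the second row to the third while subtracting the same
multiple from the first". [cite: GompfAGT2010, Thm 2.1 and §3 (Δ-moves on matrices in standard form)] -/
theorem gompf2010_deltaMove_of_surgeredMappingToriLE {f₀ : ℝ → ℝ} (hf₀ : IsDehnTwistLift f₀)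
    (h : ∀ (A : Matrix.SpecialLinearGroup (Fin 3) ℤ) (_ : IsGompfStandardForm A)
      (_ : ((A : Matrix (Fin 3) (Fin 3) ℤ) - 1).det = 1) (k : ℤ),
      SurgeredMappingToriLE.{u} (torusDiffeomorph A) ((torusDiffeomorph A).trans (hf₀.twistPow k))) :
    gompf2010_deltaMove.{u} := by
  intro A hA hdet k X _ _ _ _ _ _ hX
  obtain ⟨X', _, _, _, _, _, _, h', e⟩ := h A hA hdet k X hX.isSurgeredMappingTorusOf
  exact ⟨X', ‹_›, ‹_›, ‹_›, ‹_›, ‹_›, ‹_›,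
    h'.isCappellShanesonSphereOf_gompfDelta_zpow_mul hA hdet hf₀ k, e⟩

end DeltaMove

/-! ### Column moves are conjugate to row moves -/

section MulComm

/-- **Column moves are conjugate to row moves.** For `A, P ∈ SL(3, ℤ)` one has
`P A = A⁻¹ (A P) A`, so by the conjugation invariance of surgered mapping tori under based
diffeomorphisms of `T³` (`IsSurgeredMappingTorusOf.conj`, for the *same* `X` and the same mapping
torus; Gompf 2010, §3 ¶1: the pair of spheres "only depends on the conjugacy class of `A`", and
¶3: the column move is "the conjugate operation" of the row move) a surgered mapping torus of the
linear monodromy `A P` is one of `P A`. [cite: GompfAGT2010, §3 ¶1 (conjugacy invariance) and ¶3 (the conjugate operation on the second column)] -/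
theorem IsSurgeredMappingTorusOf.torusDiffeomorph_mul_comm {A P : Matrix.SpecialLinearGroup (Fin 3) ℤ}
    {X : Type*} [TopologicalSpace X] [ChartedSpace (𝔼 4) X]
    (h : IsSurgeredMappingTorusOf (torusDiffeomorph (A * P)) X) :
    IsSurgeredMappingTorusOf (torusDiffeomorph (P * A)) X := by
  refine (h.conj (torusDiffeomorph A) (torusDiffeomorph_apply_one A)).congr fun x ↦ ?_
  rw [Diffeomorph.coe_trans, Diffeomorph.coe_trans, Function.comp_apply, Function.comp_apply]
  have hx : torusDiffeomorph (A * P) (torusDiffeomorph A x) =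
      torusDiffeomorph A (torusDiffeomorph (P * A) x) := by
    simp only [coe_torusDiffeomorph, Matrix.SpecialLinearGroup.coe_mul, torusMap_mul,
      Function.comp_apply]
  rw [hx, Diffeomorph.symm_apply_apply]

/-- Surgered mapping tori of `A P` and of `P A` are the same manifolds (both inclusions of
`IsSurgeredMappingTorusOf.torusDiffeomorph_mul_comm`). In particular, for `P = Δᵏ`: the column
Δ-move `A ↦ A Δᵏ` and the row Δ-move `A ↦ Δᵏ A` have the same surgered mapping tori. [cite: GompfAGT2010, §3 ¶1 (conjugacy invariance) and ¶3 (the conjugate operation on the second column)] -/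
theorem isSurgeredMappingTorusOf_torusDiffeomorph_mul_comm_iff
    (A P : Matrix.SpecialLinearGroup (Fin 3) ℤ) {X : Type*} [TopologicalSpace X]
    [ChartedSpace (𝔼 4) X] :
    IsSurgeredMappingTorusOf (torusDiffeomorph (A * P)) X ↔
      IsSurgeredMappingTorusOf (torusDiffeomorph (P * A)) X :=
  ⟨fun h ↦ h.torusDiffeomorph_mul_comm, fun h ↦ h.torusDiffeomorph_mul_comm⟩

end MulComm

/-! ### Theorem 2.1 on the 3-torus in Dehn-twist form, from the row move -/

section TwistForm

/-- **Gompf 2010, Theorem 2.1, for the 3-torus and a linear monodromy in standard form — from the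
row Δ-move.** *Theorem 2.1* (R. Gompf, *More Cappell–Shaneson spheres are standard*, Algebr. Geom.
Topol. 10 (2010)): let `M` be a connected oriented 3-manifold, `φ` an orientation-preserving
self-diffeomorphism which is the identity near `p ∈ M`, `X_φ` its mapping torus, `C` the circle
through `p` and `X_φ^ε` (`ε = 0, 1`) the results of surgery on `C` with the two framings; "suppose
there is an oriented circle `α ⊂ M` containing `p`, and a torus `T ⊂ M` containing both `α` and
`φ(α)`, in which the two circles have algebraic intersection `±1` with `α ∩ φ(α)` connected.
Suppose that the framings induced by `T` on `α` and `φ(α)` correspond under `φ`. If `δ : M → M`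
denotes the Dehn twist along `T` parallel to `φ(α) - α`, then `X^ε_{φ∘δᵏ} = X^ε_φ = X^ε_{δᵏ∘φ}`
for all `k ∈ ℤ` and `ε = 0, 1`." *§3, third paragraph*: for `M = T³` and `A ∈ SL(3, ℤ)` in
standard form "Theorem 2.1 allows us to compose `A` with a Dehn twist `δ` along the torus spanned
by the first and third coordinate axes, in the direction of `A v - v = [-1 0 1]ᵀ`. That is, `δ` is
isotopic to the linear diffeomorphism `Δ` … This allows us to change `A` (in standard form) by
adding any multiple of the second row to the third while subtracting the same multiple from the
first, or by the conjugate operation on the second column, without changing the resulting pair of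
diffeomorphism types."

Formal rendering (framing-free, tree conventions: `IsSurgeredMappingTorusOf ψ X` allows both
framings, so for each `ψ` it describes Gompf's unordered pair `{X⁰, X¹}`; the linear
`torusDiffeomorph A` replaces Gompf's monodromy straightened near `0`, isotopic to it rel `0`; the
Dehn twist is `δ = torusDehnTwist f 1` for a Dehn-twist lift `f`, `δᵏ = hf.twistPow k`): **granted
the row Δ-move `gompf2010_deltaMove`** — the tree's single leaf for Theorem 2.1 on `T³` — for every
`A` in standard form with `det (A - 1) = 1`, every Dehn-twist lift `f` and every `k ∈ ℤ`, the
closed smooth 4-manifolds that are surgered mapping tori of `A ∘ δᵏ`, of `A`, and of `δᵏ ∘ A` are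
the same up to diffeomorphism (`SurgeredMappingToriLE` in all four directions). Proof, all from the
soft part of §3 already in the tree: `δ_fᵏ` on either side of `A` may be replaced by the matrix
`Δᵏ` (`δ` is isotopic to `Δ` rel the base point:
`isSurgeredMappingTorusOf_dehnTwist_trans_torusDiffeomorph_iff`,
`isSurgeredMappingTorusOf_torusDiffeomorph_trans_dehnTwist_iff`), the column move `A Δᵏ` is
conjugate to the row move `Δᵏ A` (`IsSurgeredMappingTorusOf.torusDiffeomorph_mul_comm`), and the
converse inclusions are the row move applied to `Δᵏ A` and `-k`
(`gompf2010_deltaMove.of_gompfDelta_zpow_mul`). Together with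
`gompf2010_deltaMove_of_surgeredMappingToriLE` this shows that the Dehn-twist form is *equivalent*
to the row move (D-0026: formerly a separate named fact, merged into `gompf2010_deltaMove`). [cite: GompfAGT2010, Thm 2.1 and §3 ¶3 (application to T³ in standard form; Δ-moves on matrices in standard form)] -/
theorem gompf2010_deltaMove.surgeredMappingToriLE_twistPow (hΔ : gompf2010_deltaMove.{u})
    (A : Matrix.SpecialLinearGroup (Fin 3) ℤ) (hA : IsGompfStandardForm A)
    (hdet : ((A : Matrix (Fin 3) (Fin 3) ℤ) - 1).det = 1) {f : ℝ → ℝ} (hf : IsDehnTwistLift f)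
    (k : ℤ) :
    SurgeredMappingToriLE.{u} (torusDiffeomorph A) ((hf.twistPow k).trans (torusDiffeomorph A)) ∧
    SurgeredMappingToriLE.{u} ((hf.twistPow k).trans (torusDiffeomorph A)) (torusDiffeomorph A) ∧
    SurgeredMappingToriLE.{u} (torusDiffeomorph A) ((torusDiffeomorph A).trans (hf.twistPow k)) ∧
    SurgeredMappingToriLE.{u} ((torusDiffeomorph A).trans (hf.twistPow k)) (torusDiffeomorph A) := by
  have hP := coe_torusDiffeomorph_gompfDelta_zpow k
  have h0 : (fun θ ↦ (k : ℝ) * f θ) 0 = 0 := by simp [hf.apply_zero]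
  have hdet' : (((gompfDelta ^ k * A : Matrix.SpecialLinearGroup (Fin 3) ℤ) :
      Matrix (Fin 3) (Fin 3) ℤ) - 1).det = 1 := by
    rw [hA.det_gompfDelta_zpow_mul_sub_one]; exact hdet
  refine ⟨?_, ?_, ?_, ?_⟩
  · -- `X` of `A` is diffeomorphic to some `X'` of `A ∘ δᵏ` (a sphere of `Δᵏ A`, read as one of `A Δᵏ`)
    intro X _ _ _ _ _ _ hX
    obtain ⟨X', _, _, _, _, _, _, h', e⟩ :=
      hΔ A hA hdet k X (hX.isCappellShanesonSphereOf (Or.inl hdet))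
    exact ⟨X', ‹_›, ‹_›, ‹_›, ‹_›, ‹_›, ‹_›,
      (isSurgeredMappingTorusOf_dehnTwist_trans_torusDiffeomorph_iff A (hf.contDiff_int_mul k)
        (hf.periodic_int_mul k) h0 hP).2 h'.isSurgeredMappingTorusOf.torusDiffeomorph_mul_comm, e⟩
  · -- `X` of `A ∘ δᵏ` is one of `A Δᵏ`, hence of `Δᵏ A`; apply the row move with `-k`
    intro X _ _ _ _ _ _ hX
    have h1 : IsSurgeredMappingTorusOf (torusDiffeomorph (gompfDelta ^ k * A)) X :=
      ((isSurgeredMappingTorusOf_dehnTwist_trans_torusDiffeomorph_iff A (hf.contDiff_int_mul k)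
        (hf.periodic_int_mul k) h0 hP).1 hX).torusDiffeomorph_mul_comm
    obtain ⟨X', _, _, _, _, _, _, h', e⟩ :=
      hΔ.of_gompfDelta_zpow_mul hA hdet k X (h1.isCappellShanesonSphereOf (Or.inl hdet'))
    exact ⟨X', ‹_›, ‹_›, ‹_›, ‹_›, ‹_›, ‹_›, h'.isSurgeredMappingTorusOf, e⟩
  · -- `X` of `A` is diffeomorphic to some `X'` of `δᵏ ∘ A` (a sphere of `Δᵏ A`)
    intro X _ _ _ _ _ _ hX
    obtain ⟨X', _, _, _, _, _, _, h', e⟩ :=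
      hΔ A hA hdet k X (hX.isCappellShanesonSphereOf (Or.inl hdet))
    exact ⟨X', ‹_›, ‹_›, ‹_›, ‹_›, ‹_›, ‹_›,
      (isSurgeredMappingTorusOf_torusDiffeomorph_trans_dehnTwist_iff A (hf.contDiff_int_mul k)
        (hf.periodic_int_mul k) h0 hP).2 h'.isSurgeredMappingTorusOf, e⟩
  · -- `X` of `δᵏ ∘ A` is a sphere of `Δᵏ A`; apply the row move with `-k`
    intro X _ _ _ _ _ _ hX
    obtain ⟨X', _, _, _, _, _, _, h', e⟩ := hΔ.of_gompfDelta_zpow_mul hA hdet k X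
      (hX.isCappellShanesonSphereOf_gompfDelta_zpow_mul hA hdet hf k)
    exact ⟨X', ‹_›, ‹_›, ‹_›, ‹_›, ‹_›, ‹_›, h'.isSurgeredMappingTorusOf, e⟩

end TwistForm

end Literature.Topology.FourManifolds
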